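import Literature.LinearAlgebra.Matrix.IntegerMatrixDiagonalizableOverZ
import Mathlib.GroupTheory.PGroup
import HarnessLib

/-!
# The centraliser in `GLₙ(ℤ)` of an integer matrix with `n` different integer eigenvalues is an elementary
# abelian `2`-group of order at most `2ⁿ` — «`Λ_max^{unit} ⊃ Λ^{unit} ⊃ {±1_A}`, so `|Λ^{unit}| ∈ {2, 4, ..., 2ⁿ}`»
# (Hertling–Larabi 2026b §9.1, with Theorem 6.3; Lemma 9.5 (c) for `n = 3`)

[topic LinearAlgebra/Matrix] Lane `lit-hodgefound` (Track 2 foundations library), seat p19 generation 40, row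
g40-#11 (§§1–2), and generation 41, row g41-#3 (§§3–4: the order of the centraliser is a power of `2`; for `n = 3`
it is `2`, `4` or `8`, each attained).  Sequel of `IntegerEigenvaluesUpperTriangular` (g40-#5, REUSED:
`exists_conj_upperTriangular`) and of `IntegerMatrixDiagonalizableOverZ` §4 (g40-#7: the centraliser of `diag(λ)`
itself is `{±1}ⁿ`, REUSED: `natCard_centralizer_diagonal`).  THEOREMS ONLY: no definition, no instance, no notation,
no named fact (D-0026, net Literature debt `0`), no `sorry`.

## Source, VERBATIM

C. Hertling, K. Larabi, *Conjugacy classes of regular integer matrices*, arXiv:2602.15748 (2026)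
[HertlingLarabi2026b], held `paper:arxiv-2602.15748`.  §9.1, chunk p0027 (`A = ℚe₁ + ⋯ + ℚeₙ`, the algebra of a
characteristic polynomial with `n` different integer roots): «The group of units `Λ^{unit}` of an order `Λ` is quite
different from the case of algebraic number fields. It is finite, namely
`Λ_max^{unit} = {Σᵢ εᵢeᵢ | ε₁, ..., εₙ ∈ {±1}}`, so `|Λ_max^{unit}| = 2ⁿ`, and for any order `Λ`
`Λ_max^{unit} ⊃ Λ^{unit} ⊃ {±1_A}`, so `|Λ^{unit}| ∈ {2, 4, ..., 2ⁿ}`.»  §9.3 Lemma 9.5 (c), chunk p0029 (`n = 3`):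
«The size `|Λ_{α₁α₂α₃}^{unit}|` of the set `Λ_{α₁α₂α₃}^{unit} ⊂ Λ_max^{unit} = {±e₁ ± e₂ ± e₃}` of units in
`Λ_{α₁α₂α₃}` is `2` or `4` or `8`.»  §6 Thm. 6.3, chunk p0012: the `GL_n(ℤ)`-conjugacy class of `N` is the
`ε`-class of a full lattice `L` with `𝒪(L) ⊃ Λ_f`; under this dictionary the integer matrices commuting with `N`
form the order `𝒪(L)`, and those in `GL_n(ℤ)` its unit group `𝒪(L)^{unit}`.

## What is proved (`N, X, Y : Matrix (Fin n) (Fin n) ℤ`, `χ_N = ∏ᵢ (t − λᵢ)`, `λ` injective)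

* §1 upper triangular `T` with pairwise different diagonal (any commutative ring without zero divisors):
  **`blockTriangular_of_commute`** (`XT = TX ⟹ X` upper triangular), **`eq_of_commute_of_diag_eq`** (two matrices
  commuting with `T` and with the same diagonal are equal: the commutant embeds into the diagonal, i.e. into
  `Λ_max = ℤⁿ`).
* §2 over `ℤ`: `mul_comm_of_commute` (the commutant of `N` is commutative), **`mul_self_eq_one_of_commute`**
  (`X ∈ GLₙ(ℤ)`, `XN = NX ⟹ X² = 1`: the units of an order in `ℚⁿ` are sign vectors),
  `natCard_centralizer_le` (`|C_{GLₙ(ℤ)}(N)| ≤ 2ⁿ`, via the embedding into `{±1}ⁿ`), `finite_centralizer`.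
* §3 (row g41-#3) **`natCard_centralizer_eq_two_pow`** (`|C_{GLₙ(ℤ)}(N)| = 2ᵏ` for some `k ≤ n`: the centraliser is a
  finite `2`-group inside `(Mₙ(ℤ))ˣ`, `IsPGroup.iff_card`) and `two_le_natCard_centralizer` (`±1` for `n ≥ 1`) —
  together «`|Λ^{unit}| ∈ {2, 4, ..., 2ⁿ}`».
* §4 (row g41-#3) `n = 3`: **`natCard_centralizer_three`** (`|C_{GL₃(ℤ)}(N)| ∈ {2, 4, 8}`, Lemma 9.5 (c)) and the
  three values attained: `natCard_centralizer_example_two` (`(0 0 −2; 0 3 −1; 0 0 6)`, the order `Λ_{330}`),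
  `natCard_centralizer_example_four` (`(0 0 −1; 0 1 −2; 0 0 3)`, the order `Λ_{310}`),
  `natCard_centralizer_example_eight` (`diag(0, 1, 2)`, `Λ_max`).
-/

open Matrix Polynomial

namespace Literature.LinearAlgebra.Matrix.IntegerMatrixCentralizerDistinctEigenvalues

open Literature.LinearAlgebra.Matrix.IntegerEigenvaluesTriangular (exists_conj_upperTriangular)

/-! ## §1 The commutant of an upper triangular matrix with pairwise different diagonal entries -/

section CommRing

variable {R : Type*} [CommRing R] [NoZeroDivisors R] {n : ℕ}

/-- **A matrix commuting with an upper triangular `T` whose diagonal entries are pairwise different is itself upper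
triangular** (the commutant of `[t] = Σλᵢeᵢ` inside `End(ℚⁿ)` is `A = ℚe₁ + ⋯ + ℚeₙ`, triangular in the basis (9.1)).
[cite: HertlingLarabi2026b, §9.1 (9.1)–(9.3), chunk p0027] -/
theorem blockTriangular_of_commute {T X : Matrix (Fin n) (Fin n) R} (hT : T.BlockTriangular id)
    (hd : ∀ i j, i ≠ j → T i i ≠ T j j) (hc : X * T = T * X) : X.BlockTriangular id := by
  -- `X i j = 0` for `j < i`, by induction on the measure `j * n + (n - 1 - i)`
  suffices h : ∀ m : ℕ, ∀ i j : Fin n, (j : ℕ) * n + (n - 1 - i) < m → j < i → X i j = 0 by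
    intro i j hij
    exact h _ i j (Nat.lt_succ_self _) hij
  intro m
  induction m with
  | zero => intro i j h; exact absurd h (Nat.not_lt_zero _)
  | succ m ih =>
    intro i j hm hij
    have e := congr_fun (congr_fun hc i) j
    rw [Matrix.mul_apply, Matrix.mul_apply] at e
    have hl : ∑ k, X i k * T k j = X i j * T j j := by
      refine Finset.sum_eq_single j (fun k _ hk => ?_) (fun h => absurd (Finset.mem_univ _) h)
      rcases lt_or_gt_of_ne hk with h | h
      · rw [ih i k ?_ (lt_trans h hij), zero_mul]
        have hi := i.isLt; have hk' : (k : ℕ) + 1 ≤ j := h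
        calc (k : ℕ) * n + (n - 1 - i) < (k + 1) * n := by rw [add_mul, one_mul]; omega
          _ ≤ j * n := Nat.mul_le_mul_right _ hk'
          _ ≤ m := by omega
      · rw [hT h, mul_zero]
    have hr : ∑ k, T i k * X k j = T i i * X i j := by
      refine Finset.sum_eq_single i (fun k _ hk => ?_) (fun h => absurd (Finset.mem_univ _) h)
      rcases lt_or_gt_of_ne hk with h | h
      · rw [hT h, zero_mul]
      · rw [ih k j ?_ (lt_trans hij h), mul_zero]
        have hk' := k.isLt
        have : (n - 1 - (k : ℕ)) < n - 1 - (i : ℕ) := by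
          have : (i : ℕ) < k := h
          omega
        omega
    rw [hl, hr, mul_comm (T i i)] at e
    have e' : X i j * (T j j - T i i) = 0 := by rw [mul_sub, e, sub_self]
    exact (mul_eq_zero.1 e').resolve_right (sub_ne_zero.2 (hd j i (ne_of_lt hij)))

/-- An upper triangular matrix with ZERO diagonal commuting with `T` (pairwise different diagonal) vanishes.
[cite: HertlingLarabi2026b, §9.1, chunk p0027] -/
private theorem eq_zero_of_commute {T Y : Matrix (Fin n) (Fin n) R} (hT : T.BlockTriangular id)
    (hd : ∀ i j, i ≠ j → T i i ≠ T j j) (hY : Y.BlockTriangular id) (hY0 : ∀ i, Y i i = 0)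
    (hc : Y * T = T * Y) : Y = 0 := by
  have hY' : ∀ i k : Fin n, (k : ℕ) ≤ i → Y i k = 0 := fun i k h => by
    rcases (Fin.le_def.2 h : k ≤ i).lt_or_eq with h' | h'
    · exact hY h'
    · rw [h', hY0]
  -- `Y i j = 0` for `i < j`, by induction on `j - i`
  suffices h : ∀ m : ℕ, ∀ i j : Fin n, (j : ℕ) - i < m → i < j → Y i j = 0 by
    ext i j
    rw [Matrix.zero_apply]
    by_cases hij : i < j
    · exact h _ i j (Nat.lt_succ_self _) hij
    · exact hY' i j (not_lt.1 hij)
  intro m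
  induction m with
  | zero => intro i j h; exact absurd h (Nat.not_lt_zero _)
  | succ m ih =>
    intro i j hm hij
    have e := congr_fun (congr_fun hc i) j
    rw [Matrix.mul_apply, Matrix.mul_apply] at e
    have hl : ∑ k, Y i k * T k j = Y i j * T j j := by
      refine Finset.sum_eq_single j (fun k _ hk => ?_) (fun h => absurd (Finset.mem_univ _) h)
      rcases lt_or_gt_of_ne hk with h | h
      · by_cases hik : i < k
        · rw [ih i k (by have : (i:ℕ) < k := hik; have : (k:ℕ) < j := h; omega) hik, zero_mul]
        · rw [hY' i k (not_lt.1 hik), zero_mul]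
      · rw [hT h, mul_zero]
    have hr : ∑ k, T i k * Y k j = T i i * Y i j := by
      refine Finset.sum_eq_single i (fun k _ hk => ?_) (fun h => absurd (Finset.mem_univ _) h)
      rcases lt_or_gt_of_ne hk with h | h
      · rw [hT h, zero_mul]
      · by_cases hkj : k < j
        · rw [ih k j (by have : (i:ℕ) < k := h; have : (k:ℕ) < j := hkj; omega) hkj, mul_zero]
        · rw [hY' k j (not_lt.1 hkj), mul_zero]
    rw [hl, hr, mul_comm (T i i)] at e
    have e' : Y i j * (T j j - T i i) = 0 := by rw [mul_sub, e, sub_self]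
    exact (mul_eq_zero.1 e').resolve_right (sub_ne_zero.2 (hd j i (ne_of_gt hij)))

/-- **The commutant of `T` embeds into the diagonal**: two matrices commuting with an upper triangular `T` with
pairwise different diagonal entries and having the same diagonal are equal (the order `𝒪 ⊂ A = ℚe₁ + ⋯ + ℚeₙ` is
determined inside `Λ_max = ℤe₁ + ⋯ + ℤeₙ` by its coordinates). [cite: HertlingLarabi2026b, §9.1 («`Λ_max = ℤe₁ + ... + ℤeₙ`»), chunk p0027] -/
theorem eq_of_commute_of_diag_eq {T X X' : Matrix (Fin n) (Fin n) R} (hT : T.BlockTriangular id)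
    (hd : ∀ i j, i ≠ j → T i i ≠ T j j) (hX : X * T = T * X) (hX' : X' * T = T * X')
    (hdiag : ∀ i, X i i = X' i i) : X = X' := by
  have h := eq_zero_of_commute hT hd
    ((blockTriangular_of_commute hT hd hX).sub (blockTriangular_of_commute hT hd hX'))
    (fun i => by rw [Matrix.sub_apply, hdiag, sub_self]) (by rw [sub_mul, mul_sub, hX, hX'])
  exact sub_eq_zero.1 h

omit [NoZeroDivisors R] in
/-- The diagonal of a product of upper triangular matrices. [folklore] -/
private theorem mul_apply_diag {A B : Matrix (Fin n) (Fin n) R} (hA : A.BlockTriangular id)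
    (hB : B.BlockTriangular id) (k : Fin n) : (A * B) k k = A k k * B k k := by
  rw [Matrix.mul_apply]
  refine Finset.sum_eq_single k (fun m _ hm => ?_) (fun h => absurd (Finset.mem_univ k) h)
  rcases lt_or_gt_of_ne hm with h | h
  · rw [hA h, zero_mul]
  · rw [hB h, mul_zero]

/-- **The commutant of `T` is commutative.** [cite: HertlingLarabi2026b, §9.1 (`A = ℚe₁ + ⋯ + ℚeₙ` is commutative), chunk p0027] -/
theorem mul_comm_of_commute_triangular {T X Y : Matrix (Fin n) (Fin n) R} (hT : T.BlockTriangular id)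
    (hd : ∀ i j, i ≠ j → T i i ≠ T j j) (hX : X * T = T * X) (hY : Y * T = T * Y) : X * Y = Y * X := by
  refine eq_of_commute_of_diag_eq hT hd ?_ ?_ fun i => ?_
  · rw [mul_assoc, hY, ← mul_assoc, hX, mul_assoc]
  · rw [mul_assoc, hX, ← mul_assoc, hY, mul_assoc]
  · rw [mul_apply_diag (blockTriangular_of_commute hT hd hX) (blockTriangular_of_commute hT hd hY),
      mul_apply_diag (blockTriangular_of_commute hT hd hY) (blockTriangular_of_commute hT hd hX), mul_comm]

end CommRing

/-! ## §2 Integer matrices with `n` different integer eigenvalues -/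

variable {n : ℕ}

/-- `PN = TP`, `P ∈ GLₙ(ℤ)`: a matrix commuting with `N` is conjugated into one commuting with `T`. [folklore] -/
private theorem commute_conj {N T P X : Matrix (Fin n) (Fin n) ℤ} (hP : IsUnit P.det) (h : P * N = T * P)
    (hX : X * N = N * X) : (P * X * P⁻¹) * T = T * (P * X * P⁻¹) := by
  have hT : T = P * N * P⁻¹ := by rw [h, Matrix.mul_nonsing_inv_cancel_right P _ hP]
  rw [hT]
  calc P * X * P⁻¹ * (P * N * P⁻¹) = P * X * (P⁻¹ * P) * N * P⁻¹ := by simp only [Matrix.mul_assoc]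
    _ = P * (X * N) * P⁻¹ := by rw [Matrix.nonsing_inv_mul P hP, Matrix.mul_one, Matrix.mul_assoc P]
    _ = P * (N * X) * P⁻¹ := by rw [hX]
    _ = P * N * (P⁻¹ * P) * X * P⁻¹ := by
        rw [Matrix.nonsing_inv_mul P hP, Matrix.mul_one]; simp only [Matrix.mul_assoc]
    _ = P * N * P⁻¹ * (P * X * P⁻¹) := by simp only [Matrix.mul_assoc]

/-- **The commutant of an integer matrix with `n` different integer eigenvalues is commutative** (it is the order
`𝒪(L) ⊂ A = ℚe₁ + ⋯ + ℚeₙ`). [cite: HertlingLarabi2026b, §9.1, chunk p0027, with §6 Thm. 6.3, chunk p0012] -/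
theorem mul_comm_of_commute {N B B' : Matrix (Fin n) (Fin n) ℤ} {l : Fin n → ℤ}
    (h : N.charpoly = ∏ i, (X - C (l i))) (hl : Function.Injective l) (hB : B * N = N * B)
    (hB' : B' * N = N * B') : B * B' = B' * B := by
  obtain ⟨P, T, hP, hPN, hT, hTd⟩ := exists_conj_upperTriangular h
  have hd : ∀ i j, i ≠ j → T i i ≠ T j j := fun i j hij => by rw [hTd, hTd]; exact fun e => hij (hl e)
  have e := mul_comm_of_commute_triangular hT hd (commute_conj hP hPN hB) (commute_conj hP hPN hB')
  have e' : P * (B * B') * P⁻¹ = P * (B' * B) * P⁻¹ := by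
    calc P * (B * B') * P⁻¹ = P * B * (P⁻¹ * P) * B' * P⁻¹ := by
          rw [Matrix.nonsing_inv_mul P hP, Matrix.mul_one]; simp only [Matrix.mul_assoc]
      _ = (P * B * P⁻¹) * (P * B' * P⁻¹) := by simp only [Matrix.mul_assoc]
      _ = (P * B' * P⁻¹) * (P * B * P⁻¹) := e
      _ = P * B' * (P⁻¹ * P) * B * P⁻¹ := by simp only [Matrix.mul_assoc]
      _ = P * (B' * B) * P⁻¹ := by rw [Matrix.nonsing_inv_mul P hP, Matrix.mul_one]; simp only [Matrix.mul_assoc]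
  calc B * B' = P⁻¹ * (P * (B * B') * P⁻¹) * P := by
        rw [← Matrix.mul_assoc, ← Matrix.mul_assoc, Matrix.nonsing_inv_mul P hP, Matrix.one_mul,
          Matrix.nonsing_inv_mul_cancel_right P _ hP]
    _ = P⁻¹ * (P * (B' * B) * P⁻¹) * P := by rw [e']
    _ = B' * B := by
        rw [← Matrix.mul_assoc, ← Matrix.mul_assoc, Matrix.nonsing_inv_mul P hP, Matrix.one_mul,
          Matrix.nonsing_inv_mul_cancel_right P _ hP]

/-- **Every element of the centraliser `C_{GLₙ(ℤ)}(N)` is an involution**: if `χ_N = ∏ᵢ (t − λᵢ)` with pairwise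
different `λᵢ ∈ ℤ`, `X ∈ GLₙ(ℤ)` and `XN = NX`, then `X² = 1` — the units of the order `𝒪(L)` lie in
`Λ_max^{unit} = {Σ εᵢeᵢ | εᵢ = ±1}`. [cite: HertlingLarabi2026b, §9.1 («`Λ_max^{unit} ⊃ Λ^{unit} ⊃ {±1_A}`»), chunk p0027, with §6 Thm. 6.3, chunk p0012] -/
theorem mul_self_eq_one_of_commute {N B : Matrix (Fin n) (Fin n) ℤ} {l : Fin n → ℤ}
    (h : N.charpoly = ∏ i, (X - C (l i))) (hl : Function.Injective l) (hBu : IsUnit B.det)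
    (hB : B * N = N * B) : B * B = 1 := by
  obtain ⟨P, T, hP, hPN, hT, hTd⟩ := exists_conj_upperTriangular h
  have hd : ∀ i j, i ≠ j → T i i ≠ T j j := fun i j hij => by rw [hTd, hTd]; exact fun e => hij (hl e)
  set X' := P * B * P⁻¹ with hX'
  have hc : X' * T = T * X' := commute_conj hP hPN hB
  have htri := blockTriangular_of_commute hT hd hc
  -- the diagonal entries of `X'` are units of `ℤ`
  have hX'u : IsUnit X'.det := by
    rw [hX', det_mul, det_mul]; exact (hP.mul hBu).mul (Matrix.isUnit_nonsing_inv_det P hP)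
  rw [Matrix.det_of_upperTriangular htri] at hX'u
  have hdiag : ∀ i, X' i i * X' i i = 1 := fun i => Int.isUnit_mul_self (IsUnit.prod_univ_iff.1 hX'u i)
  -- `X'² = 1` by the embedding into the diagonal
  have hsq : X' * X' = 1 := by
    refine eq_of_commute_of_diag_eq hT hd (by rw [mul_assoc, hc, ← mul_assoc, hc, mul_assoc])
      (by rw [one_mul, mul_one]) fun i => ?_
    rw [mul_apply_diag htri htri, hdiag, Matrix.one_apply_eq]
  -- back to `B`
  have e : B = P⁻¹ * X' * P := by
    rw [hX', ← Matrix.mul_assoc, ← Matrix.mul_assoc, Matrix.nonsing_inv_mul P hP, Matrix.one_mul,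
      Matrix.nonsing_inv_mul_cancel_right P _ hP]
  calc B * B = P⁻¹ * X' * (P * P⁻¹) * X' * P := by rw [e]; simp only [Matrix.mul_assoc]
    _ = P⁻¹ * (X' * X') * P := by rw [Matrix.mul_nonsing_inv P hP, Matrix.mul_one]; simp only [Matrix.mul_assoc]
    _ = 1 := by rw [hsq, Matrix.mul_one, Matrix.nonsing_inv_mul P hP]

/-- The sign-vector map `X ↦ diag(PXP⁻¹)` embeds `C_{GLₙ(ℤ)}(N)` into `{±1}ⁿ = Λ_max^{unit}`. [folklore] -/
private theorem exists_injective_units {N : Matrix (Fin n) (Fin n) ℤ} {l : Fin n → ℤ}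
    (h : N.charpoly = ∏ i, (X - C (l i))) (hl : Function.Injective l) :
    ∃ F : {X : Matrix (Fin n) (Fin n) ℤ // IsUnit X.det ∧ X * N = N * X} → (Fin n → ℤˣ),
      Function.Injective F := by
  classical
  obtain ⟨P, T, hP, hPN, hT, hTd⟩ := exists_conj_upperTriangular h
  have hd : ∀ i j, i ≠ j → T i i ≠ T j j := fun i j hij => by rw [hTd, hTd]; exact fun e => hij (hl e)
  -- the diagonal of `PXP⁻¹` consists of units
  have hu : ∀ X : {X : Matrix (Fin n) (Fin n) ℤ // IsUnit X.det ∧ X * N = N * X}, ∀ i,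
      IsUnit ((P * X.1 * P⁻¹) i i) := by
    rintro ⟨X, hXu, hX⟩ i
    have htri := blockTriangular_of_commute hT hd (commute_conj hP hPN hX)
    have hX'u : IsUnit (P * X * P⁻¹).det := by
      rw [det_mul, det_mul]; exact (hP.mul hXu).mul (Matrix.isUnit_nonsing_inv_det P hP)
    rw [Matrix.det_of_upperTriangular htri] at hX'u
    exact IsUnit.prod_univ_iff.1 hX'u i
  refine ⟨fun X i => (hu X i).unit, ?_⟩
  rintro ⟨X, hXu, hX⟩ ⟨Y, hYu, hY⟩ hXY
  have hdiag : ∀ i, (P * X * P⁻¹) i i = (P * Y * P⁻¹) i i := fun i => by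
    have e := congr_arg (fun u : ℤˣ => (u : ℤ)) (congr_fun hXY i)
    simpa only [IsUnit.unit_spec] using e
  have e := eq_of_commute_of_diag_eq hT hd (commute_conj hP hPN hX) (commute_conj hP hPN hY) hdiag
  refine Subtype.ext ?_
  calc X = P⁻¹ * (P * X * P⁻¹) * P := by
        rw [← Matrix.mul_assoc, ← Matrix.mul_assoc, Matrix.nonsing_inv_mul P hP, Matrix.one_mul,
          Matrix.nonsing_inv_mul_cancel_right P _ hP]
    _ = P⁻¹ * (P * Y * P⁻¹) * P := by rw [e]
    _ = Y := by
        rw [← Matrix.mul_assoc, ← Matrix.mul_assoc, Matrix.nonsing_inv_mul P hP, Matrix.one_mul,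
          Matrix.nonsing_inv_mul_cancel_right P _ hP]

/-- **`|C_{GLₙ(ℤ)}(N)| ≤ 2ⁿ`**: the centraliser in `GLₙ(ℤ)` of an integer matrix with `n` different integer
eigenvalues has at most `2ⁿ` elements («`|Λ^{unit}| ∈ {2, 4, ..., 2ⁿ}`»; for `n = 3`: `2`, `4` or `8`, Lemma 9.5 (c)).
[cite: HertlingLarabi2026b, §9.1, chunk p0027; §9.3 Lemma 9.5 (c), chunk p0029] -/
theorem natCard_centralizer_le {N : Matrix (Fin n) (Fin n) ℤ} {l : Fin n → ℤ}
    (h : N.charpoly = ∏ i, (X - C (l i))) (hl : Function.Injective l) :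
    Nat.card {X : Matrix (Fin n) (Fin n) ℤ // IsUnit X.det ∧ X * N = N * X} ≤ 2 ^ n := by
  classical
  obtain ⟨F, hF⟩ := exists_injective_units h hl
  calc Nat.card {X : Matrix (Fin n) (Fin n) ℤ // IsUnit X.det ∧ X * N = N * X}
      ≤ Nat.card (Fin n → ℤˣ) := Nat.card_le_card_of_injective F hF
    _ = 2 ^ n := by rw [Nat.card_eq_fintype_card, Fintype.card_fun, Fintype.card_fin, Fintype.card_units_int]

/-- The centraliser in `GLₙ(ℤ)` of an integer matrix with `n` different integer eigenvalues is finite («It is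
finite»). [cite: HertlingLarabi2026b, §9.1, chunk p0027] -/
theorem finite_centralizer {N : Matrix (Fin n) (Fin n) ℤ} {l : Fin n → ℤ}
    (h : N.charpoly = ∏ i, (X - C (l i))) (hl : Function.Injective l) :
    Finite {X : Matrix (Fin n) (Fin n) ℤ // IsUnit X.det ∧ X * N = N * X} := by
  obtain ⟨F, hF⟩ := exists_injective_units h hl
  exact Finite.of_injective F hF

/-! ## §3 «`|Λ^{unit}| ∈ {2, 4, ..., 2ⁿ}`»: the order of the centraliser is a power of two (row g41-#3) -/

/-- The inverse of a unit commuting with `N` commutes with `N`. [folklore] -/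
private theorem inv_commute_of_commute {N : Matrix (Fin n) (Fin n) ℤ} (u : (Matrix (Fin n) (Fin n) ℤ)ˣ)
    (hu : (u : Matrix (Fin n) (Fin n) ℤ) * N = N * (u : Matrix (Fin n) (Fin n) ℤ)) :
    ((u⁻¹ : (Matrix (Fin n) (Fin n) ℤ)ˣ) : Matrix (Fin n) (Fin n) ℤ) * N =
      N * ((u⁻¹ : (Matrix (Fin n) (Fin n) ℤ)ˣ) : Matrix (Fin n) (Fin n) ℤ) := by
  set v : Matrix (Fin n) (Fin n) ℤ := ((u⁻¹ : (Matrix (Fin n) (Fin n) ℤ)ˣ) : Matrix (Fin n) (Fin n) ℤ) with hv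
  have h1 : (u : Matrix (Fin n) (Fin n) ℤ) * v = 1 := by rw [hv, Units.mul_inv]
  have h2 : v * (u : Matrix (Fin n) (Fin n) ℤ) = 1 := by rw [hv, Units.inv_mul]
  calc v * N = v * N * ((u : Matrix (Fin n) (Fin n) ℤ) * v) := by rw [h1, Matrix.mul_one]
    _ = v * (N * (u : Matrix (Fin n) (Fin n) ℤ)) * v := by simp only [Matrix.mul_assoc]
    _ = v * ((u : Matrix (Fin n) (Fin n) ℤ) * N) * v := by rw [hu]
    _ = N * v := by rw [← Matrix.mul_assoc, h2, Matrix.one_mul]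

/-- **`|C_{GLₙ(ℤ)}(N)| = 2ᵏ` for some `k ≤ n`**: the centraliser in `GLₙ(ℤ)` of an integer matrix with `n` different
integer eigenvalues is a finite group all of whose elements are involutions (`mul_self_eq_one_of_commute`), hence a
`2`-group, so its order is a power of `2` — «`|Λ^{unit}| ∈ {2, 4, ..., 2ⁿ}`».
[cite: HertlingLarabi2026b, §9.1, chunk p0027, with §6 Thm. 6.3, chunk p0012] -/
theorem natCard_centralizer_eq_two_pow {N : Matrix (Fin n) (Fin n) ℤ} {l : Fin n → ℤ}
    (h : N.charpoly = ∏ i, (X - C (l i))) (hl : Function.Injective l) :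
    ∃ k : ℕ, k ≤ n ∧ Nat.card {X : Matrix (Fin n) (Fin n) ℤ // IsUnit X.det ∧ X * N = N * X} = 2 ^ k := by
  classical
  -- the centraliser as a subgroup of the unit group of `Mₙ(ℤ)`
  let H : Subgroup (Matrix (Fin n) (Fin n) ℤ)ˣ :=
    { carrier := {u | (u : Matrix (Fin n) (Fin n) ℤ) * N = N * u}
      mul_mem' := fun {u v} hu hv => by
        show (u : Matrix (Fin n) (Fin n) ℤ) * v * N = N * (u * v)
        rw [Matrix.mul_assoc, hv, ← Matrix.mul_assoc, hu, Matrix.mul_assoc]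
      one_mem' := by
        show (1 : Matrix (Fin n) (Fin n) ℤ) * N = N * 1
        rw [Matrix.one_mul, Matrix.mul_one]
      inv_mem' := fun {u} hu => inv_commute_of_commute u hu }
  have e : H ≃ {X : Matrix (Fin n) (Fin n) ℤ // IsUnit X.det ∧ X * N = N * X} :=
    { toFun := fun u => ⟨(u.1 : Matrix (Fin n) (Fin n) ℤ), (Matrix.isUnit_iff_isUnit_det _).1 u.1.isUnit, u.2⟩
      invFun := fun X => ⟨((Matrix.isUnit_iff_isUnit_det X.1).2 X.2.1).unit, by
        show ((((Matrix.isUnit_iff_isUnit_det X.1).2 X.2.1).unit : (Matrix (Fin n) (Fin n) ℤ)ˣ) :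
          Matrix (Fin n) (Fin n) ℤ) * N = N * _
        rw [IsUnit.unit_spec]
        exact X.2.2⟩
      left_inv := fun u => Subtype.ext (Units.ext
        (IsUnit.unit_spec ((Matrix.isUnit_iff_isUnit_det (u.1 : Matrix (Fin n) (Fin n) ℤ)).2
          ((Matrix.isUnit_iff_isUnit_det _).1 u.1.isUnit))))
      right_inv := fun X => Subtype.ext (IsUnit.unit_spec ((Matrix.isUnit_iff_isUnit_det X.1).2 X.2.1)) }
  haveI : Finite {X : Matrix (Fin n) (Fin n) ℤ // IsUnit X.det ∧ X * N = N * X} := finite_centralizer h hl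
  haveI : Finite H := Finite.of_equiv _ e.symm
  haveI : Fact (Nat.Prime 2) := ⟨Nat.prime_two⟩
  -- every element is an involution
  have hP : IsPGroup 2 H := by
    intro g
    refine ⟨1, ?_⟩
    rw [pow_one, pow_two]
    apply Subtype.ext
    apply Units.ext
    show ((g : (Matrix (Fin n) (Fin n) ℤ)ˣ) : Matrix (Fin n) (Fin n) ℤ) * (g : (Matrix (Fin n) (Fin n) ℤ)ˣ) = 1
    exact mul_self_eq_one_of_commute h hl
      ((Matrix.isUnit_iff_isUnit_det _).1 (g : (Matrix (Fin n) (Fin n) ℤ)ˣ).isUnit) g.2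
  obtain ⟨k, hk⟩ := IsPGroup.iff_card.1 hP
  rw [Nat.card_congr e] at hk
  refine ⟨k, ?_, hk⟩
  have hle := natCard_centralizer_le h hl
  rw [hk] at hle
  exact (pow_le_pow_iff_right₀ (by norm_num : 1 < 2)).1 hle

/-- **`|C_{GLₙ(ℤ)}(N)| ≥ 2` for `n ≥ 1`**: `±1` are two different elements («`Λ^{unit} ⊃ {±1_A}`»).
[cite: HertlingLarabi2026b, §9.1, chunk p0027] -/
theorem two_le_natCard_centralizer (hn : 0 < n) {N : Matrix (Fin n) (Fin n) ℤ} {l : Fin n → ℤ}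
    (h : N.charpoly = ∏ i, (X - C (l i))) (hl : Function.Injective l) :
    2 ≤ Nat.card {X : Matrix (Fin n) (Fin n) ℤ // IsUnit X.det ∧ X * N = N * X} := by
  haveI : Finite {X : Matrix (Fin n) (Fin n) ℤ // IsUnit X.det ∧ X * N = N * X} := finite_centralizer h hl
  have hneg : IsUnit (-1 : Matrix (Fin n) (Fin n) ℤ).det :=
    (Matrix.isUnit_iff_isUnit_det _).1 (IsUnit.of_mul_eq_one (-1) (by rw [neg_mul_neg, Matrix.one_mul]))
  haveI : Nontrivial {X : Matrix (Fin n) (Fin n) ℤ // IsUnit X.det ∧ X * N = N * X} :=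
    ⟨⟨⟨1, by simp, by rw [Matrix.one_mul, Matrix.mul_one]⟩,
      ⟨-1, hneg, by rw [neg_mul, mul_neg, Matrix.one_mul, Matrix.mul_one]⟩, fun e => by
        have := congr_fun (congr_fun (congr_arg Subtype.val e) ⟨0, hn⟩) ⟨0, hn⟩
        simp at this⟩⟩
  exact Finite.one_lt_card_iff_nontrivial.2 inferInstance

/-! ## §4 `n = 3`: «`|Λ_{α₁α₂α₃}^{unit}|` is `2` or `4` or `8`» (Lemma 9.5 (c)), with all three values attained (row g41-#3) -/

/-- **LEMMA 9.5 (c), first sentence, matrix form**: for an integer `3 × 3` matrix `N` with three different integer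
eigenvalues, `|C_{GL₃(ℤ)}(N)| ∈ {2, 4, 8}`. [cite: HertlingLarabi2026b, §9.3 Lemma 9.5 (c), chunk p0029; §9.1, chunk p0027] -/
theorem natCard_centralizer_three {N : Matrix (Fin 3) (Fin 3) ℤ} {l₁ l₂ l₃ : ℤ}
    (h : N.charpoly = (X - C l₁) * (X - C l₂) * (X - C l₃)) (h₁₂ : l₁ ≠ l₂) (h₂₃ : l₂ ≠ l₃) (h₁₃ : l₁ ≠ l₃) :
    Nat.card {X : Matrix (Fin 3) (Fin 3) ℤ // IsUnit X.det ∧ X * N = N * X} = 2 ∨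
      Nat.card {X : Matrix (Fin 3) (Fin 3) ℤ // IsUnit X.det ∧ X * N = N * X} = 4 ∨
      Nat.card {X : Matrix (Fin 3) (Fin 3) ℤ // IsUnit X.det ∧ X * N = N * X} = 8 := by
  have h' : N.charpoly = ∏ i, (X - C (![l₁, l₂, l₃] i)) := by
    rw [h, Fin.prod_univ_three]
    simp
  have hl : Function.Injective ![l₁, l₂, l₃] := by
    intro i j hij
    fin_cases i <;> fin_cases j <;> simp at hij ⊢ <;> first
      | exact absurd hij h₁₂ | exact absurd hij.symm h₁₂ | exact absurd hij h₂₃ | exact absurd hij.symm h₂₃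
      | exact absurd hij h₁₃ | exact absurd hij.symm h₁₃
  obtain ⟨k, hk, hcard⟩ := natCard_centralizer_eq_two_pow h' hl
  have h2 := two_le_natCard_centralizer (by norm_num) h' hl
  rw [hcard] at h2 ⊢
  interval_cases k
  · norm_num at h2
  · exact Or.inl rfl
  · exact Or.inr (Or.inl rfl)
  · exact Or.inr (Or.inr rfl)

/-- The value `2` is attained: for `T = (0 0 −2; 0 3 −1; 0 0 6)` (eigenvalues `0, 3, 6`; the matrix of
`0·e₁ + 3·e₂ + 6·e₃` in the `ℤ`-basis `(3e₁, 3e₂, 1_A)` of the order `Λ_{330}`, whose only units are `±1_A`) the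
centraliser in `GL₃(ℤ)` is `{±1}`. [cite: HertlingLarabi2026b, §9.3 Lemma 9.5 (c) («In most cases it is `2`, then `Λ^{unit} = {±1_A}`»), chunk p0029] -/
theorem natCard_centralizer_example_two :
    Nat.card {X : Matrix (Fin 3) (Fin 3) ℤ // IsUnit X.det ∧
      X * !![0, 0, -2; 0, 3, -1; 0, 0, 6] = !![0, 0, -2; 0, 3, -1; 0, 0, 6] * X} = 2 := by
  -- the centraliser is `{1, −1}`
  have key : ∀ X : Matrix (Fin 3) (Fin 3) ℤ, IsUnit X.det →
      X * !![0, 0, -2; 0, 3, -1; 0, 0, 6] = !![0, 0, -2; 0, 3, -1; 0, 0, 6] * X → X = 1 ∨ X = -1 := by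
    intro X hX hc
    have e := fun i j => congr_fun (congr_fun hc i) j
    have h20 : X 2 0 = 0 := by have := e 2 0; simp [Matrix.mul_apply, Fin.sum_univ_three] at this; omega
    have h10 : X 1 0 = 0 := by have := e 1 0; simp [Matrix.mul_apply, Fin.sum_univ_three, h20] at this; omega
    have h21 : X 2 1 = 0 := by have := e 2 1; simp [Matrix.mul_apply, Fin.sum_univ_three] at this; omega
    have h01 : X 0 1 = 0 := by have := e 0 1; simp [Matrix.mul_apply, Fin.sum_univ_three] at this; omega
    have h02 : 3 * X 0 2 = X 0 0 - X 2 2 := by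
      have := e 0 2; simp [Matrix.mul_apply, Fin.sum_univ_three, h01] at this; omega
    have h12 : 3 * X 1 2 = X 1 1 - X 2 2 := by
      have := e 1 2; simp [Matrix.mul_apply, Fin.sum_univ_three] at this; omega
    have hdet : X.det = X 0 0 * X 1 1 * X 2 2 := by
      rw [Matrix.det_fin_three, h10, h20, h21]; ring
    rw [hdet] at hX
    have u0 := Int.isUnit_iff.1 (isUnit_of_mul_isUnit_left (isUnit_of_mul_isUnit_left hX))
    have u1 := Int.isUnit_iff.1 (isUnit_of_mul_isUnit_right (isUnit_of_mul_isUnit_left hX))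
    have u2 := Int.isUnit_iff.1 (isUnit_of_mul_isUnit_right hX)
    have h00 : X 0 0 = X 2 2 := by omega
    have h11 : X 1 1 = X 2 2 := by omega
    rcases u2 with h2 | h2
    · left
      have a00 : X 0 0 = 1 := by omega
      have a11 : X 1 1 = 1 := by omega
      have a02 : X 0 2 = 0 := by omega
      have a12 : X 1 2 = 0 := by omega
      ext i j
      fin_cases i <;> fin_cases j <;> simp [h10, h20, h21, h01, a00, a11, a02, a12, h2]
    · right
      have a00 : X 0 0 = -1 := by omega
      have a11 : X 1 1 = -1 := by omega
      have a02 : X 0 2 = 0 := by omega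
      have a12 : X 1 2 = 0 := by omega
      ext i j
      fin_cases i <;> fin_cases j <;> simp [h10, h20, h21, h01, a00, a11, a02, a12, h2]
  rw [Nat.card_eq_two_iff]
  refine ⟨⟨1, by simp, by rw [Matrix.one_mul, Matrix.mul_one]⟩,
    ⟨-1, (Matrix.isUnit_iff_isUnit_det _).1 (IsUnit.of_mul_eq_one (-1) (by rw [neg_mul_neg, Matrix.one_mul])),
      by rw [neg_mul, mul_neg, Matrix.one_mul, Matrix.mul_one]⟩, fun e => ?_, ?_⟩
  · have := congr_fun (congr_fun (congr_arg Subtype.val e) 0) 0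
    simp at this
  · ext X
    simp only [Set.mem_insert_iff, Set.mem_singleton_iff, Set.mem_univ, iff_true]
    rcases key X.1 X.2.1 X.2.2 with hX | hX
    · exact Or.inl (Subtype.ext hX)
    · exact Or.inr (Subtype.ext hX)

/-- The value `4` is attained: for `T = (0 0 −1; 0 1 −2; 0 0 3)` (eigenvalues `0, 1, 3`; the matrix of
`0·e₁ + 1·e₂ + 3·e₃` in the `ℤ`-basis `(3e₁, e₂, 1_A)` of the order `Λ_{310}`, `|Λ_{310}^{unit}| = 4`) the centraliser
in `GL₃(ℤ)` consists of the four matrices `(ε₁ 0 0; 0 ε₂ ε₂−ε₁; 0 0 ε₁)`, `εᵢ = ±1`.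
[cite: HertlingLarabi2026b, §9.3 Lemma 9.5 (c) (`|Λ^{unit}| = 4` for `(α₁, 1, 0)`, `α₁ ≥ 3`), chunk p0029] -/
theorem natCard_centralizer_example_four :
    Nat.card {X : Matrix (Fin 3) (Fin 3) ℤ // IsUnit X.det ∧
      X * !![0, 0, -1; 0, 1, -2; 0, 0, 3] = !![0, 0, -1; 0, 1, -2; 0, 0, 3] * X} = 4 := by
  -- the parametrisation by `(ε₁, ε₂) ∈ ℤˣ × ℤˣ`
  have hmem : ∀ ε : ℤˣ × ℤˣ, IsUnit (!![(ε.1 : ℤ), 0, 0; 0, (ε.2 : ℤ), (ε.2 : ℤ) - ε.1; 0, 0, (ε.1 : ℤ)] :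
      Matrix (Fin 3) (Fin 3) ℤ).det ∧
      (!![(ε.1 : ℤ), 0, 0; 0, (ε.2 : ℤ), (ε.2 : ℤ) - ε.1; 0, 0, (ε.1 : ℤ)] : Matrix (Fin 3) (Fin 3) ℤ) *
        !![0, 0, -1; 0, 1, -2; 0, 0, 3] =
        !![0, 0, -1; 0, 1, -2; 0, 0, 3] * !![(ε.1 : ℤ), 0, 0; 0, (ε.2 : ℤ), (ε.2 : ℤ) - ε.1; 0, 0, (ε.1 : ℤ)] := by
    rintro ⟨ε₁, ε₂⟩
    constructor
    · rw [Matrix.det_fin_three]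
      simp
    · rw [Matrix.mul_fin_three, Matrix.mul_fin_three]
      ext i j
      fin_cases i <;> fin_cases j <;> simp [mul_comm]
      ring
  have key : ∀ X : Matrix (Fin 3) (Fin 3) ℤ, IsUnit X.det →
      X * !![0, 0, -1; 0, 1, -2; 0, 0, 3] = !![0, 0, -1; 0, 1, -2; 0, 0, 3] * X →
      ∃ ε : ℤˣ × ℤˣ, X = !![(ε.1 : ℤ), 0, 0; 0, (ε.2 : ℤ), (ε.2 : ℤ) - ε.1; 0, 0, (ε.1 : ℤ)] := by
    intro X hX hc
    have e := fun i j => congr_fun (congr_fun hc i) j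
    have h20 : X 2 0 = 0 := by have := e 2 0; simp [Matrix.mul_apply, Fin.sum_univ_three] at this; omega
    have h10 : X 1 0 = 0 := by have := e 1 0; simp [Matrix.mul_apply, Fin.sum_univ_three, h20] at this; omega
    have h21 : X 2 1 = 0 := by have := e 2 1; simp [Matrix.mul_apply, Fin.sum_univ_three] at this; omega
    have h01 : X 0 1 = 0 := by have := e 0 1; simp [Matrix.mul_apply, Fin.sum_univ_three] at this; omega
    have h02 : 3 * X 0 2 = X 0 0 - X 2 2 := by
      have := e 0 2; simp [Matrix.mul_apply, Fin.sum_univ_three, h01] at this; omega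
    have h12 : 2 * X 1 2 = 2 * X 1 1 - 2 * X 2 2 := by
      have := e 1 2; simp [Matrix.mul_apply, Fin.sum_univ_three] at this; omega
    have hdet : X.det = X 0 0 * X 1 1 * X 2 2 := by
      rw [Matrix.det_fin_three, h10, h20, h21]; ring
    rw [hdet] at hX
    have hu0 := isUnit_of_mul_isUnit_left (isUnit_of_mul_isUnit_left hX)
    have hu1 := isUnit_of_mul_isUnit_right (isUnit_of_mul_isUnit_left hX)
    have u0 := Int.isUnit_iff.1 hu0
    have u2 := Int.isUnit_iff.1 (isUnit_of_mul_isUnit_right hX)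
    have h00 : X 0 0 = X 2 2 := by omega
    refine ⟨(hu0.unit, hu1.unit), ?_⟩
    ext i j
    fin_cases i <;> fin_cases j <;> simp [IsUnit.unit_spec] <;> omega
  rw [show (4 : ℕ) = Nat.card (ℤˣ × ℤˣ) by
    rw [Nat.card_eq_fintype_card, Fintype.card_prod, Fintype.card_units_int]]
  refine (Nat.card_eq_of_bijective (fun ε : ℤˣ × ℤˣ =>
    (⟨!![(ε.1 : ℤ), 0, 0; 0, (ε.2 : ℤ), (ε.2 : ℤ) - ε.1; 0, 0, (ε.1 : ℤ)], hmem ε⟩ :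
      {X : Matrix (Fin 3) (Fin 3) ℤ // IsUnit X.det ∧
        X * !![0, 0, -1; 0, 1, -2; 0, 0, 3] = !![0, 0, -1; 0, 1, -2; 0, 0, 3] * X})) ⟨?_, ?_⟩).symm
  · rintro ⟨ε₁, ε₂⟩ ⟨ε₁', ε₂'⟩ hεε
    have e := fun i j => congr_fun (congr_fun (congr_arg Subtype.val hεε) i) j
    have e0 := e 0 0
    have e1 := e 1 1
    simp at e0 e1
    exact Prod.ext (Units.ext e0) (Units.ext e1)
  · rintro ⟨X, hX, hc⟩
    obtain ⟨ε, hε⟩ := key X hX hc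
    exact ⟨ε, Subtype.ext hε.symm⟩

/-- The value `8 = 2³` is attained by the diagonal matrices (`IntegerMatrixDiagonalizableOverZ`,
`natCard_centralizer_diagonal`): e.g. `diag(0, 1, 2)`. [cite: HertlingLarabi2026b, §9.1 (`|Λ_max^{unit}| = 2ⁿ`), chunk p0027] -/
theorem natCard_centralizer_example_eight :
    Nat.card {P : Matrix (Fin 3) (Fin 3) ℤ // IsUnit P.det ∧
      P * Matrix.diagonal ![(0 : ℤ), 1, 2] = Matrix.diagonal ![(0 : ℤ), 1, 2] * P} = 8 := by
  have hl : Function.Injective ![(0 : ℤ), 1, 2] := by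
    intro i j hij
    fin_cases i <;> fin_cases j <;> simp at hij ⊢
  simpa using IntegerMatrixDiagonalizableOverZ.natCard_centralizer_diagonal hl

end Literature.LinearAlgebra.Matrix.IntegerMatrixCentralizerDistinctEigenvalues
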